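import Summits.ResolutionOfSingularities.ResolutionOfSingularities.Theorems.UniformComplexityCampaignW82SeparableTightnessPencil
import Literature.AlgebraicGeometry.Morphisms.AffineSpaceCompactification
import Literature.AlgebraicGeometry.Motives.GenericFibre
import Mathlib.RingTheory.Localization.FractionRing
import HarnessLib

/-!
# [OURS · L1 W8.2] Separable tightness of resolution in families — the compactified Kollár pencil

Cell `res-hironaka` (run/shared/lean/pub/res-hironaka/), LADDER-RESOLUTION rung L (RESCUE), slot W8.2, door 2
(`UniformComplexity`, host item `PrimeModelTransfer` stmt-ResolutionOfSingularities-8933); prover res-L1-s82-pv-2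
(gen 7). THESES-FREE module (imports the gen-7 sibling `…SeparableTightnessPencil` (p556612), the tree files
`Literature.AlgebraicGeometry.Morphisms.AffineSpaceCompactification` (an affine scheme of finite type over any
base is compactifiable, Stacks 0F41 first step) and `Literature.AlgebraicGeometry.Motives.GenericFibre`
(`isSchemeTheoreticallyDominant_toImage`, Stacks 01R8), Mathlib, `HarnessLib`).

CONTENT — the WITNESS FAMILY of the separable-tightness theorem (`…SeparableTightness`, headline
`not_familyResolutionSep`), i.e. a family satisfying the HYPOTHESES of `CampaignW82.FamilyResolution(Sep)`:
* `exists_compactifiedPencil` — over any commutative ring `A`, the Kollár pencil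
  `Spec A[x,y]/(y^q − (x^p − t)) → Spec A` is a quasi-compact scheme-theoretically dominant OPEN subscheme of a
  scheme `𝒳̄` PROPER over `Spec A` (compactify in `𝐏ⁿ_A`, then pass to the scheme-theoretic image).
* `isIntegral_pullback_of_pencil_dense` — for such a family and a FLAT ring map `φ₀ : A → L` to a field,
  `𝒳̄ ×_A Spec L` is INTEGRAL (it contains the integral curve `C_1(L, φ₀ t)` as the flat base change of the
  dense pencil; `isIntegral_of_flat_of_isPullback`). With `L = (Frac A)^{alg}` this is «integral geometric
  generic fibre».
* `ringHom_flat_of_injective_of_field` — an injective ring map from a domain to a field is flat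
  (`A → Frac A → L`).

HONEST FRAMING. OURS negative-side bookkeeping for the campaign statement `CampaignW82.FamilyResolutionSep`
(p554368); NOT a statement of H. Hironaka's 2017 manuscript ([Hironaka2017]); nothing here is attributed to its
author. AI work, weaker than expert review.

## References (vocabulary and locators only)
* The Stacks Project, Tags 0F41 (compactifications), 01R8 (scheme-theoretic image), 0CMK. [StacksProject]
* J. Kollár, *Lectures on Resolution of Singularities* (2007), 1.19. [Kollar2007]
-/

noncomputable section

set_option linter.dupNamespace false -- mandated namespace of this single-conjunct summit

open Polynomial
open _root_.CategoryTheory _root_.CategoryTheory.Limits _root_.AlgebraicGeometry _root_.TopologicalSpace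
open Literature.AlgebraicGeometry.Resolution

namespace Summit.ResolutionOfSingularities.ResolutionOfSingularities.Theorems.CampaignW82.SeparableTightness

/-! ## The compactified pencil -/

section Compactification

variable (A : Type) [CommRing A] (p : ℕ) (t : A) (q : ℕ)

/-- **The compactified Kollár pencil.** Over any commutative ring `A`, the pencil
`Spec A[x,y]/(y^q − (x^p − t)) → Spec A` (affine, of finite type) embeds as a quasi-compact,
scheme-theoretically dominant open subscheme of a scheme `𝒳̄` PROPER over `Spec A`: compactify in projective
space over `Spec A` (tree: `Literature.AlgebraicGeometry.Morphisms.exists_compactification_of_isAffine`, Stacks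
0F41 first step) and replace the compactification by the scheme-theoretic image of the pencil (Mathlib
`Scheme.Hom.toImage`, an open immersion for a quasi-compact immersion; scheme-theoretically dominant by
`Literature.AlgebraicGeometry.Motives.isSchemeTheoreticallyDominant_toImage`, Stacks 01R8). [cite: StacksProject, Tag 0F41] -/
theorem exists_compactifiedPencil :
    ∃ (𝒳 : Scheme.{0}) (f : 𝒳 ⟶ Spec (.of A)) (j : pencil A p t q ⟶ 𝒳),
      IsProper f ∧ IsOpenImmersion j ∧ QuasiCompact j ∧ IsSchemeTheoreticallyDominant j ∧
        j ≫ f = pencilTo A p t q := by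
  haveI := locallyOfFiniteType_pencilTo A p t q
  obtain ⟨Xc, j₀, g, hj₀, hg, hfac⟩ :=
    Literature.AlgebraicGeometry.Morphisms.exists_compactification_of_isAffine (pencilTo A p t q)
  haveI := hj₀
  haveI := hg
  haveI : QuasiCompact (j₀ ≫ g) := by rw [hfac]; infer_instance
  haveI : QuasiCompact j₀ := .of_comp j₀ g
  haveI : IsSchemeTheoreticallyDominant j₀.toImage :=
    Literature.AlgebraicGeometry.Motives.isSchemeTheoreticallyDominant_toImage j₀
  refine ⟨j₀.image, j₀.imageι ≫ g, j₀.toImage, inferInstance, inferInstance, inferInstance, inferInstance, ?_⟩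
  rw [j₀.toImage_imageι_assoc, hfac]

variable {A}

/-- **Flat field-valued fibres of a family containing the pencil densely are integral.** If
`f : 𝒳 → Spec A` contains the pencil as a quasi-compact scheme-theoretically dominant open over `A` and
`φ₀ : A → L` is a FLAT ring map to a field (e.g. `A` a domain and `φ₀` injective: `A → Frac A → L`), then
`𝒳 ×_{Spec A} Spec L` is an integral scheme — it contains the integral curve `C_1(L, φ₀ t)`
(`isIntegral_pullback_pencil`) as the base change of the dense pencil (`isIntegral_of_flat_of_isPullback`).
With `φ₀ = (A → (Frac A)^{alg})` this is the hypothesis «integral geometric generic fibre» of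
`CampaignW82.FamilyResolution(Sep)` for the compactified pencil. [cite: StacksProject, Tag 0CMK] -/
theorem isIntegral_pullback_of_pencil_dense [Fact p.Prime] [Fact q.Prime] (hqp : q ≠ p)
    {𝒳 : Scheme.{0}} (f : 𝒳 ⟶ Spec (.of A))
    (j : pencil A p t q ⟶ 𝒳) [QuasiCompact j] [IsSchemeTheoreticallyDominant j] (hj : j ≫ f = pencilTo A p t q)
    {L : Type} [Field L] (φ₀ : A →+* L) (hflat : φ₀.Flat) :
    IsIntegral (pullback f (Spec.map (CommRingCat.ofHom φ₀))) := by
  set b := pullback.fst f (Spec.map (CommRingCat.ofHom φ₀)) with hb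
  haveI : Flat (Spec.map (CommRingCat.ofHom φ₀)) := (HasRingHomProperty.Spec_iff (P := @Flat)).mpr hflat
  haveI : Flat b := inferInstance
  have sq₀ : IsPullback b (pullback.snd f (Spec.map (CommRingCat.ofHom φ₀))) f
      (Spec.map (CommRingCat.ofHom φ₀)) := IsPullback.of_hasPullback _ _
  have sqP : IsPullback (pullback.fst j b) (pullback.snd j b) j b := IsPullback.of_hasPullback j b
  have sqP' : IsPullback (pullback.fst j b) (pullback.snd j b ≫ pullback.snd f (Spec.map (CommRingCat.ofHom φ₀)))
      (pencilTo A p t q) (Spec.map (CommRingCat.ofHom φ₀)) := by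
    rw [← hj]; exact sqP.paste_vert sq₀
  haveI : IsIntegral (pullback (pencilTo A p t q) (Spec.map (CommRingCat.ofHom φ₀))) :=
    isIntegral_pullback_pencil A p t q hqp φ₀
  haveI : Nonempty ↥(pullback j b) := ⟨sqP'.isoPullback.inv (Classical.arbitrary _)⟩
  haveI : IsIntegral (pullback j b) := isIntegral_of_isOpenImmersion sqP'.isoPullback.hom
  exact isIntegral_of_flat_of_isPullback j b sqP

/-- An injective ring map from a domain to a field is flat (`A → Frac A → L`: a localization followed by a
field extension). [folklore] -/
theorem ringHom_flat_of_injective_of_field {A L : Type} [CommRing A] [IsDomain A] [Field L] (φ₀ : A →+* L)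
    (hφ : Function.Injective φ₀) : φ₀.Flat := by
  algebraize [φ₀]
  haveI : FaithfulSMul A L := (faithfulSMul_iff_algebraMap_injective A L).mpr hφ
  letI : Algebra (FractionRing A) L := FractionRing.liftAlgebra A L
  change Module.Flat A L
  haveI : Module.Flat A (FractionRing A) := IsLocalization.flat (FractionRing A) (nonZeroDivisors A)
  exact Module.Flat.trans A (FractionRing A) L

end Compactification

end Summit.ResolutionOfSingularities.ResolutionOfSingularities.Theorems.CampaignW82.SeparableTightness

end
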